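import Literature.AlgebraicGeometry.Motives.SeesawGrauertGluing
import Literature.AlgebraicGeometry.Motives.CartierDivisorCech
import Mathlib.Algebra.Module.LocalizedModule.Away
import HarnessLib

/-!
# Sections of `𝒪(D)` over the preimage of a basic open are a localization (Görtz–Wedhorn I, Thm. 7.22; Görtz–Wedhorn II, Cor. 23.137 at the flat algebras `A_a`)

`Motives/SeesawGrauertGluing` reduced the named fact `grothendieckComplex_sectionsOver`
(`Motives/SeesawGrauert`: the Grothendieck complex of `𝒪(D)` on `pr_T : X ×_K T → T` in degree `0`,
with sections over all opens, fibres and their compatibility) to its basic-open form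
`grothendieckComplex_sectionsOver_basicOpen`: isomorphisms `Γ(pr_T⁻¹T_a, 𝒪(D)) ≅ Ker(d|_{T_a})`
on the non-empty basic opens `T_a` of an affine open `V = Spec A`, natural in `T_b ⊆ T_a`. In the
printed source (Görtz–Wedhorn II, Cor. 23.137; Mumford, *Abelian Varieties*, §5) these come from
ONE `A`-linear isomorphism `Γ(pr_T⁻¹V, 𝒪(D)) = H⁰(K^•) ≅ Ker(d)` by the flat base change `A → A_a`:
`H⁰(K^• ⊗_A A_a) = H⁰(K^•) ⊗_A A_a` (localization is exact) and
`Γ(pr_T⁻¹T_a, 𝒪(D)) = Γ(pr_T⁻¹V, 𝒪(D))_a` (Görtz–Wedhorn I, Thm. 7.22: sections of a quasi-coherent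
module over a principal open of a qcqs scheme). This file proves both localization statements in
the language of this tree, for a morphism `π : W → B` with `W` integral, a Cartier divisor `D` on
`W` (`Motives/CartierDivisor`) and an affine open `V ⊆ B`:

* `CartierDivisor.sectionsOverMod` — `Γ(π⁻¹U, 𝒪_W(D)) ⊆ K(W)` (`U ⊆ V`) as a `Γ(V, 𝒪_B)`-submodule
  (`CartierDivisor.sectionsOn` of `Motives/CartierDivisorSectionsOn` for `π⁻¹U`, the base ring
  acting through `CartierDivisor.baseAlgebra` of `Motives/CartierDivisorCech`), with the same
  elements as the subgroup `CartierDivisor.sectionsOver` of `Motives/SeesawGrauert`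
  (`sectionsOverAddEquiv`);
* `CartierDivisor.exists_ofSection_app_pow_mul_isSectionOver` — PROVED: for `π` quasi-compact,
  every section over `π⁻¹B_a` becomes a section over `π⁻¹V` after multiplication by a power of
  `π^♯(a)` (finite affine cover of `π⁻¹V` inside the charts; on each piece
  `RatFn.exists_pow_mul_eq_ofSection`, i.e. `Γ(D(g), 𝒪) = Γ(W_k, 𝒪)_g`);
  `CartierDivisor.isLocalizedModule_sectionsOverMod` — PROVED: the inclusion
  `Γ(π⁻¹V, 𝒪(D)) ⊆ Γ(π⁻¹B_a, 𝒪(D))` is a localization away from `a`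
  (Mathlib `IsLocalizedModule.Away`);

The second half of the localization step (kernels of matrices over `Γ(B_a, 𝒪_B) = Γ(V, 𝒪_B)_a`
and the induced isomorphisms `Γ(π⁻¹B_a, 𝒪(D)) ≅ Ker(d|_{B_a})`, natural in `a`) is
`Motives/SectionsOverLocEquiv`; the application to `pr_T : X ×_K T → T` is
`Motives/SeesawGrauertLocalization`. Mathlib searched (pin): `IsLocalizedModule.Away.mk`,
`Module.End.isUnit_iff`, `Module.algebraMap_end_apply`, `Scheme.Hom.isCompact_preimage`,
`Scheme.isBasis_affineOpens`, `IsCompact.elim_finite_subcover`, `Scheme.preimage_basicOpen`,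
`Scheme.basicOpen_res`, `Submodule.inclusion` (all used); no statement about sections of
`𝒪_X(D)` over principal opens exists in Mathlib (`Mathlib/AlgebraicGeometry/Modules/Tilde` treats
`M~` on `Spec A` only).

## References

* U. Görtz, T. Wedhorn, *Algebraic Geometry I: Schemes*, 2nd ed., Springer Spektrum (2020),
  doi:10.1007/978-3-658-30733-2: Thm. 7.22, p. 188 (`Γ(D(f), 𝓕) = Γ(X, 𝓕)_f` on qcqs schemes);
  (11.9), pp. 373–374 (`Γ(V, 𝒪_X(D))`). [GortzWedhorn2020]
* U. Görtz, T. Wedhorn, *Algebraic Geometry II: Cohomology of Schemes*, Springer Spektrum (2023),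
  doi:10.1007/978-3-658-43031-3: Cor. 23.135, Cor. 23.137, p. 480 (read via the held copy).
  [GortzWedhorn2023]
* D. Mumford, *Abelian Varieties*, TIFR Studies in Mathematics 5 (1970): §5 (the Grothendieck
  complex and its base change). [MumfordAV1970]
-/

universe u

open CategoryTheory CategoryTheory.Limits AlgebraicGeometry TopologicalSpace Opposite Matrix
open Literature.AlgebraicGeometry.Motives.RatFn

noncomputable section

namespace Literature.AlgebraicGeometry.Motives

namespace CartierDivisor

variable {W B : Scheme.{u}} [IsIntegral W] (π : W ⟶ B) (D : CartierDivisor W) {V : B.Opens}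
  (hgen : genericPoint W ∈ π ⁻¹ᵁ V)

/-! ### `Γ(π⁻¹U, 𝒪_W(D))` as a `Γ(V, 𝒪_B)`-module -/

/-- **`Γ(π⁻¹U, 𝒪_W(D)) ⊆ K(W)` as a `Γ(V, 𝒪_B)`-submodule** for an open `U ⊆ V`, the ring
`Γ(V, 𝒪_B)` acting on `K(W)` through `Γ(V, 𝒪_B) → Γ(π⁻¹V, 𝒪_W) → K(W)`
(`CartierDivisor.baseAlgebra`; these functions are regular on `π⁻¹V ⊇ π⁻¹U`). Its carrier is
`CartierDivisor.sectionsOver` (`mem_sectionsOverMod_iff`); Görtz–Wedhorn I, (11.9):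
`Γ(π⁻¹U, 𝒪_X(D)) = {f ∈ K(X) ; f_i f ∈ Γ(U_i ∩ π⁻¹U, 𝒪_X)}` is a `Γ(π⁻¹U, 𝒪_X)`-module.
[cite: GortzWedhorn2020, Section (11.9) (p. 374)] -/
def sectionsOverMod (U : B.Opens) (hUV : U ≤ V) :
    letI := baseAlgebra π V hgen
    Submodule Γ(B, V) W.functionField :=
  letI := baseAlgebra π V hgen
  D.sectionsOn (π ⁻¹ᵁ U) fun a _ hy => isRegularAt_baseAlgebra_algebraMap π V hgen a (hUV hy)

variable {π D}

/-- Membership in `sectionsOverMod` is `IsSectionOver`. [folklore] -/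
@[simp] theorem mem_sectionsOverMod_iff {U : B.Opens} {hUV : U ≤ V} {s : W.functionField} :
    s ∈ D.sectionsOverMod π hgen U hUV ↔ D.IsSectionOver π U s := Iff.rfl

/-- `sectionsOverMod U` and `sectionsOver U` have the same elements. [folklore] -/
theorem mem_sectionsOverMod_iff_mem_sectionsOver {U : B.Opens} {hUV : U ≤ V}
    {s : W.functionField} : s ∈ D.sectionsOverMod π hgen U hUV ↔ s ∈ D.sectionsOver π U :=
  Iff.rfl

/-- Restriction is inclusion: `Γ(π⁻¹U, 𝒪(D)) ⊆ Γ(π⁻¹U', 𝒪(D))` for `U' ⊆ U`. [folklore] -/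
theorem sectionsOverMod_mono {U U' : B.Opens} (hUV : U ≤ V) (hU'U : U' ≤ U) :
    D.sectionsOverMod π hgen U hUV ≤ D.sectionsOverMod π hgen U' (hU'U.trans hUV) :=
  fun _ hs => IsSectionOver.mono hs hU'U

/-- The additive isomorphism `Γ(π⁻¹U, 𝒪(D)) ≅ Γ(π⁻¹U, 𝒪(D))` between the subgroup
`sectionsOver` and the submodule `sectionsOverMod` (identity on rational functions). [folklore] -/
def sectionsOverAddEquiv (U : B.Opens) (hUV : U ≤ V) :
    D.sectionsOver π U ≃+ D.sectionsOverMod π hgen U hUV where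
  toFun s := ⟨s, s.2⟩
  invFun s := ⟨s, s.2⟩
  left_inv _ := rfl
  right_inv _ := rfl
  map_add' _ _ := rfl

/-- `sectionsOverAddEquiv` is the identity on rational functions. [folklore] -/
@[simp] theorem coe_sectionsOverAddEquiv {U : B.Opens} (hUV : U ≤ V) (s : D.sectionsOver π U) :
    (sectionsOverAddEquiv (D := D) (hgen := hgen) U hUV s : W.functionField) = s := rfl

/-- The inverse of `sectionsOverAddEquiv` is the identity on rational functions. [folklore] -/
@[simp] theorem coe_sectionsOverAddEquiv_symm {U : B.Opens} (hUV : U ≤ V)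
    (s : D.sectionsOverMod π hgen U hUV) :
    ((sectionsOverAddEquiv (D := D) (hgen := hgen) U hUV).symm s : W.functionField) = s := rfl

/-! ### The function `π^♯(a)` of `a ∈ Γ(V, 𝒪_B)` -/

/-- The scalar `a ∈ Γ(V, 𝒪_B)` acts on `K(W)` by the rational function of `π^♯(a)`. [folklore] -/
theorem algebraMap_baseAlgebra_eq (a : Γ(B, V)) :
    letI := baseAlgebra π V hgen
    algebraMap Γ(B, V) W.functionField a = ofSection hgen (π.app V a) := rfl

/-- `π⁻¹(B_a) = W_{π^♯ a}`: a point `y` lies over the basic open `B_a` iff `π^♯(a)` is a unit at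
`y` (Mathlib `Scheme.preimage_basicOpen`). [folklore] -/
theorem isUnitAt_ofSection_app_iff (a : Γ(B, V)) {y : W} (hy : y ∈ π ⁻¹ᵁ V) :
    IsUnitAt y (ofSection hgen (π.app V a)) ↔ π y ∈ B.basicOpen a := by
  have e : ofSection hgen (π.app V a) = ofSection (genericPoint_mem_of_mem hy) (π.app V a) := rfl
  rw [e, isUnitAt_ofSection_iff hy, ← Scheme.preimage_basicOpen]
  rfl

/-- `π^♯(a) ≠ 0` in `K(W)` as soon as `π⁻¹(B_a) ≠ ∅`. [folklore] -/
theorem ofSection_app_ne_zero (a : Γ(B, V)) (ha : genericPoint W ∈ π ⁻¹ᵁ B.basicOpen a) :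
    ofSection hgen (π.app V a) ≠ 0 :=
  ((isUnitAt_ofSection_app_iff hgen a hgen).2 ha).ne_zero

/-- `π^♯(a)` is regular on `π⁻¹V`. [folklore] -/
theorem isRegularAt_ofSection_app (a : Γ(B, V)) {y : W} (hy : y ∈ π ⁻¹ᵁ V) :
    IsRegularAt y (ofSection hgen (π.app V a)) :=
  isRegularAt_baseAlgebra_algebraMap π V hgen a hy

/-- Multiplying a section over `π⁻¹B_a` by `π^♯(a)⁻¹` gives a section over `π⁻¹B_a`. [folklore] -/
theorem IsSectionOver.inv_ofSection_app_mul {a : Γ(B, V)} {s : W.functionField}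
    (hs : D.IsSectionOver π (B.basicOpen a) s) :
    D.IsSectionOver π (B.basicOpen a) ((ofSection hgen (π.app V a))⁻¹ * s) :=
  fun i y hi hy => by
    rw [mul_left_comm]
    exact ((isUnitAt_ofSection_app_iff hgen a (B.basicOpen_le a hy)).2 hy).inv.isRegularAt.mul
      (hs i y hi hy)

/-- Multiplying a section over `π⁻¹U`, `U ⊆ V`, by a power of `π^♯(a)` gives a section over
`π⁻¹U`. [folklore] -/
theorem IsSectionOver.ofSection_app_pow_mul {U : B.Opens} (hUV : U ≤ V) (a : Γ(B, V)) (n : ℕ)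
    {s : W.functionField} (hs : D.IsSectionOver π U s) :
    D.IsSectionOver π U (ofSection hgen (π.app V a) ^ n * s) :=
  fun i y hi hy => by
    rw [mul_left_comm]
    exact ((isRegularAt_ofSection_app hgen a (hUV hy)).pow n).mul (hs i y hi hy)

/-! ### Clearing denominators: `Γ(π⁻¹B_a, 𝒪(D)) = Γ(π⁻¹V, 𝒪(D))[1/a]` -/

variable (π D) in
/-- **Sections over `π⁻¹(B_a)` have only poles of bounded order along `a = 0`**: if `π` is
quasi-compact and `V` is affine then for every `s ∈ Γ(π⁻¹B_a, 𝒪_W(D))` some `π^♯(a)^N s` lies in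
`Γ(π⁻¹V, 𝒪_W(D))` — on each of finitely many affine opens `W_k ⊆ U_{i_k}` covering the
quasi-compact `π⁻¹V`, `f_{i_k} s` is regular on the principal open `(W_k)_{π^♯ a}`, hence of the
form `b / π^♯(a)^{N_k}` with `b ∈ Γ(W_k, 𝒪_W)` (`Γ(D(g), 𝒪) = Γ(W_k, 𝒪)_g`; this tree's
`RatFn.exists_pow_mul_eq_ofSection`), and `N = Σ N_k` works (Görtz–Wedhorn I, Thm. 7.22: sections
of a quasi-coherent module over a principal open of a qcqs scheme). [folklore] -/
theorem exists_ofSection_app_pow_mul_isSectionOver [QuasiCompact π] (hV : IsAffineOpen V)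
    (a : Γ(B, V)) {s : W.functionField} (hs : D.IsSectionOver π (B.basicOpen a) s) :
    ∃ N : ℕ, D.IsSectionOver π V (ofSection hgen (π.app V a) ^ N * s) := by
  classical
  set α : W.functionField := ofSection hgen (π.app V a) with hα
  by_cases ha : genericPoint W ∈ π ⁻¹ᵁ B.basicOpen a
  swap
  · -- `π⁻¹B_a = ∅`, so `π^♯ a = 0`
    have h0 : α = 0 := by
      by_contra h
      exact ha ((isUnitAt_ofSection_app_iff hgen a hgen).1 (isUnitAt_genericPoint h))
    refine ⟨1, ?_⟩
    rw [h0, pow_one, zero_mul]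
    intro i y _ _
    rw [mul_zero]
    exact isRegularAt_zero
  -- affine opens inside the charts, around every point of `π⁻¹V`
  have hx : ∀ y : (π ⁻¹ᵁ V : W.Opens), ∃ (O : W.Opens) (i : D.ι),
      (y : W) ∈ O ∧ IsAffineOpen O ∧ O ≤ π ⁻¹ᵁ V ∧ O ≤ D.U i := by
    intro y
    obtain ⟨i, hi⟩ := D.covers y
    obtain ⟨O, hOB, hyO, hOle⟩ := (Opens.isBasis_iff_nbhd.1 W.isBasis_affineOpens)
      (show (y : W) ∈ π ⁻¹ᵁ V ⊓ D.U i from ⟨y.2, hi⟩)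
    exact ⟨O, i, hyO, hOB, hOle.trans inf_le_left, hOle.trans inf_le_right⟩
  choose O i hyO hOaff hOle hOU using hx
  -- finitely many of them cover the quasi-compact `π⁻¹V`
  have hc : IsCompact ((π ⁻¹ᵁ V : W.Opens) : Set W) := π.isCompact_preimage hV.isCompact
  obtain ⟨t, ht⟩ := hc.elim_finite_subcover (fun y => (O y : Set W)) (fun y => (O y).isOpen)
    fun y hy => Set.mem_iUnion.2 ⟨⟨y, hy⟩, hyO ⟨y, hy⟩⟩
  -- on each `O_y`, clear the denominator of `f_{i_y} s`
  have hloc : ∀ y : (π ⁻¹ᵁ V : W.Opens), ∃ N : ℕ, D.IsSectionOn (O y) (α ^ N * s) := by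
    intro y
    let g : Γ(W, O y) := W.presheaf.map (homOfLE (hOle y)).op (π.app V a)
    have hg : W.basicOpen g = O y ⊓ π ⁻¹ᵁ B.basicOpen a := by
      rw [Scheme.basicOpen_res, Scheme.preimage_basicOpen]
    have hηg : genericPoint W ∈ W.basicOpen g := by
      rw [hg]; exact ⟨genericPoint_mem_of_mem (hyO y), ha⟩
    have hβ : ∀ z ∈ W.basicOpen g, IsRegularAt z (D.f (i y) * s) := by
      intro z hz
      rw [hg] at hz
      exact hs (i y) z (hOU y hz.1) hz.2
    obtain ⟨N, b, hb⟩ := exists_pow_mul_eq_ofSection (hOaff y) g hηg hβ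
    have eg : ofSection (W.basicOpen_le g hηg) g = α := by
      rw [hα]
      exact ofSection_map (homOfLE (hOle y)) _ (π.app V a)
    refine ⟨N, (isSectionOn_iff_of_le (hOU y)).2 fun z hz => ?_⟩
    rw [mul_left_comm, ← eg, hb]
    exact isRegularAt_ofSection hz b
  choose N hN using hloc
  -- `N = Σ_{y ∈ t} N_y` works everywhere
  refine ⟨∑ y ∈ t, N y, fun j z hj hz => ?_⟩
  obtain ⟨y, hy⟩ := Set.mem_iUnion.1 (ht hz)
  obtain ⟨hyt, hzy⟩ := Set.mem_iUnion.1 hy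
  have hsplit : ∑ y' ∈ t, N y' = (∑ y' ∈ t.erase y, N y') + N y := by
    rw [← Finset.sum_erase_add _ _ hyt]
  have e : D.f j * (α ^ (∑ y' ∈ t, N y') * s) =
      α ^ (∑ y' ∈ t.erase y, N y') * (D.f j * (α ^ N y * s)) := by
    rw [hsplit, pow_add]; ring
  rw [e]
  exact ((isRegularAt_ofSection_app hgen a hz).pow _).mul (hN y j z hj hzy)

/-! ### `Γ(π⁻¹B_a, 𝒪(D))` is the localization of `Γ(π⁻¹V, 𝒪(D))` away from `a` -/

variable (π D) in
/-- **`Γ(π⁻¹B_a, 𝒪_W(D)) = Γ(π⁻¹V, 𝒪_W(D))_a`**: for `π` quasi-compact, `V` affine and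
`π⁻¹B_a ≠ ∅`, the inclusion `Γ(π⁻¹V, 𝒪_W(D)) ⊆ Γ(π⁻¹B_a, 𝒪_W(D))` of `Γ(V, 𝒪_B)`-modules is a
localization away from `a` (Mathlib `IsLocalizedModule.Away`): `a` acts invertibly on the target
(through the unit `π^♯(a)|_{π⁻¹B_a}`), every section over `π⁻¹B_a` becomes a section over `π⁻¹V`
after multiplication by a power of `a` (`exists_ofSection_app_pow_mul_isSectionOver`), and the
inclusion is injective (Görtz–Wedhorn I, Thm. 7.22 (2): `Γ(D(f), 𝓕) = Γ(X, 𝓕)_f` for `𝓕`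
quasi-coherent on `X` qcqs). [cite: GortzWedhorn2020, Thm. 7.22 (p. 188)] -/
theorem isLocalizedModule_sectionsOverMod [QuasiCompact π] (hV : IsAffineOpen V) (a : Γ(B, V))
    (ha : genericPoint W ∈ π ⁻¹ᵁ B.basicOpen a) :
    letI := baseAlgebra π V hgen
    IsLocalizedModule.Away a (Submodule.inclusion
      (sectionsOverMod_mono (D := D) (hgen := hgen) (le_refl V) (B.basicOpen_le a))) := by
  letI := baseAlgebra π V hgen
  have hα0 : ofSection hgen (π.app V a) ≠ 0 := ofSection_app_ne_zero hgen a ha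
  have hsmul : ∀ (c : Γ(B, V)) (x : D.sectionsOverMod π hgen (B.basicOpen a) (B.basicOpen_le a)),
      ((c • x : D.sectionsOverMod π hgen (B.basicOpen a) (B.basicOpen_le a)) : W.functionField) =
        ofSection hgen (π.app V c) * x := fun c x => by
    rw [Submodule.coe_smul, Algebra.smul_def]; rfl
  refine IsLocalizedModule.Away.mk ?_ ?_ ?_
  · -- `a` acts bijectively on `Γ(π⁻¹B_a, 𝒪(D))`
    refine (Module.End.isUnit_iff _).2 ⟨fun x y hxy => ?_, fun x => ?_⟩
    · have h := congr_arg Subtype.val hxy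
      simp only [Module.algebraMap_end_apply, hsmul] at h
      exact Subtype.ext (mul_left_cancel₀ hα0 h)
    · refine ⟨⟨(ofSection hgen (π.app V a))⁻¹ * x, IsSectionOver.inv_ofSection_app_mul hgen x.2⟩, ?_⟩
      apply Subtype.ext
      rw [Module.algebraMap_end_apply, hsmul]
      exact mul_inv_cancel_left₀ hα0 _
  · -- denominators clear
    intro x
    obtain ⟨N, hN⟩ := exists_ofSection_app_pow_mul_isSectionOver π D hgen hV a x.2
    refine ⟨N, ⟨ofSection hgen (π.app V a) ^ N * x, hN⟩, Subtype.ext ?_⟩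
    have e : ofSection hgen ((π.app V a) ^ N) = ofSection hgen (π.app V a) ^ N :=
      map_pow (W.presheaf.germ (π ⁻¹ᵁ V) (genericPoint W) hgen).hom _ _
    rw [hsmul, map_pow, e]
    rfl
  · -- the inclusion is injective
    intro x y hxy
    obtain rfl := Submodule.inclusion_injective _ hxy
    exact ⟨0, rfl⟩

end CartierDivisor

end Literature.AlgebraicGeometry.Motives

end
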